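import Mathlib
import Summits.NavierStokesRegularity.NavierStokesRegularity.Theses.EfficiencyFloor
import Summits.NavierStokesRegularity.NavierStokesRegularity.Theorems.EfficiencyFloorEfficiencyConcentrationCore
import HarnessLib

/-!
# `EfficiencyFloor.EfficiencyConcentration` — efficiency of vortex stretching forces enstrophy
concentration at the dissipation–production scale (item stmt-NavierStokesRegularity-23111)

**Statement (route `EfficiencyFloor`, support; registered stub `stub_efficiencyConcentration` of the
crux `ProductionEfficiencyDecay`).** For every `ε > 0` there are `K, δ > 0` such that every smooth
divergence-free `v : ℝ³ → ℝ³` with `v, Dv, D²v ∈ L²`, enstrophy `Z = ∫|curl v|² > 0`, palinstrophy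
`Pal = ∫|D curl v|²_F > 0` and stretching `S = ∫⟨ω, Dv ω⟩ ≥ ε Z^{3/4} Pal^{3/4}` (`ω = curl v`)
carries `δ Z` of its enstrophy in one ball of radius `K (Z/Pal)^{1/2}`. We prove it with `K = 4`
and `δ = min 1 (ε⁴/(4(C₂+1)²))`, `C₂ = 128 K_S³ (1+L²)√(2(1+L²))` (`K_S` Mathlib's Sobolev constant,
`L` a Lipschitz bound of a fixed bump).

PROOF (elementary; no Besov spaces, no heat kernel). Put `R = (Z/Pal)^{1/2}` and let `χ` be a smooth
bump, `= 1` on `B(0,1)`, supported in `B(0,2)`; `ψ_a(x) = χ((x−a)/R)`, `g_a = ψ_a ω`. Suppose every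
ball `B(a, 4R)` carries `< δZ` enstrophy. The translates form a continuous partition of unity:
`∫_a ψ_a(x)² da ≥ |B_R|` for every `x`, whence (Tonelli)
`S ≤ ∫|ω|²‖Dv‖ ≤ |B_R|⁻¹ ∫_a ∫_x ψ_a²|ω|²‖Dv‖ ≤ |B_R|⁻¹ ∫_a ‖g_a‖²_{L⁴} ‖Dv‖_{L²(B(a,2R))} da`.
Cauchy–Schwarz in `a`, `∫_a ‖Dv‖²_{L²(B(a,2R))} = |B_{2R}| ∫‖Dv‖² ≤ |B_{2R}| Z` (the `L²` `div`–`curl`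
estimate) and the 3D Gagliardo–Nirenberg inequality `‖g‖⁴₄ ≤ K_S³ ‖g‖₂ ‖Dg‖₂³` with
`‖g_a‖₂² < δZ`, `‖Dg_a‖₂² ≤ 2∫_{B(a,2R)}(‖Dω‖² + (L/R)²|ω|²) ≤ 2Pal(1+L²δ)` and
`∫_a ‖Dg_a‖₂² da ≤ 2|B_{2R}|(1+L²)Pal` (`Z/R² = Pal`) give, with `|B_{2R}| = 8|B_R|`,
`S ≤ 8 (2K_S³ √(δZ) √(2Pal(1+L²δ)) (1+L²) Pal Z)^{1/2} ≤ C δ^{1/4} Z^{3/4} Pal^{3/4}`, contradicting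
the efficiency hypothesis by the choice of `δ` (`final_algebra`). Parts I–II:
`…EfficiencyConcentrationTools`, `…EfficiencyConcentrationCore`.

HONEST FRAMING: a structural lemma about smooth divergence-free `H²` fields on `ℝ³` (the first
structural lemma of the `EfficiencyFloor` line: efficiency on a window ⇒ persistent concentration at
the scale `(Z/Pal)^{1/2}`); nothing here bears on Navier–Stokes regularity.

References: L. Lu, C. R. Doering, Indiana Univ. Math. J. 57 (2008) 2693–2727 (the sharp-exponent
envelope `S ≤ c Z^{3/4} Pal^{3/4}`); L. C. Evans, *PDE* (2010) §5.6.1 (Gagliardo–Nirenberg–Sobolev).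
-/

noncomputable section

set_option linter.dupNamespace false

namespace Summit.NavierStokesRegularity.NavierStokesRegularity.Theorems

open MeasureTheory Metric Set Filter Topology Function
open scoped ENNReal NNReal InnerProductSpace
open Literature.Analysis.FluidPDE
open EfficiencyConcentration

set_option maxHeartbeats 400000 in
/-- **Item stmt-NavierStokesRegularity-23111** (`EfficiencyFloor.EfficiencyConcentration`): for every
`ε > 0` there are `K, δ > 0` (here `K = 4`) such that every smooth divergence-free `H²` field on `ℝ³`
whose vortex-stretching production is at least `ε Z^{3/4} Pal^{3/4}` carries a `δ`-fraction of its
enstrophy `Z` in one ball of radius `K (Z/Pal)^{1/2}`. Continuous partition of unity by translates of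
one bump + Cauchy–Schwarz in the centre + 3D Gagliardo–Nirenberg + the `L²` `div`–`curl` estimate.
[this file] -/
theorem efficiencyFloor_efficiencyConcentration_proof :
    Summit.NavierStokesRegularity.NavierStokesRegularity.Theses.EfficiencyFloor.EfficiencyConcentration := by
  unfold Summit.NavierStokesRegularity.NavierStokesRegularity.Theses.EfficiencyFloor.EfficiencyConcentration
  intro ε hε
  -- the bump, its Lipschitz constant, the Sobolev constant, `δ`
  obtain ⟨χ, hχin, hχout⟩ :
      ∃ χ : ContDiffBump (0 : EuclideanSpace ℝ (Fin 3)), χ.rIn = 1 ∧ χ.rOut = 2 :=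
    ⟨⟨1, 2, one_pos, one_lt_two⟩, rfl, rfl⟩
  obtain ⟨L, hL0, hL⟩ := exists_bound_fderiv_bump χ
  set K : ℝ := (SNormLESNormFDerivOfEqConst (EuclideanSpace ℝ (Fin 3))
    (volume : Measure (EuclideanSpace ℝ (Fin 3))) 2 : ℝ) with hK
  have hK0 : 0 ≤ K := by rw [hK]; positivity
  set C₂ : ℝ := 128 * K ^ 3 * (1 + L ^ 2) * Real.sqrt (2 * (1 + L ^ 2)) with hC₂
  set δ : ℝ := min 1 (ε ^ 4 / (4 * (C₂ + 1) ^ 2)) with hδ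
  have hC₂0 : 0 ≤ C₂ := by positivity
  have hδ0 : 0 < δ := lt_min one_pos (by positivity)
  have hδ1 : δ ≤ 1 := min_le_left _ _
  have hδb : δ ≤ ε ^ 4 / (4 * (C₂ + 1) ^ 2) := min_le_right _ _
  refine ⟨4, δ, by norm_num, hδ0, ?_⟩
  intro v hv hdiv h0 _ _ hZ hPal hS
  set Z : ℝ := ∫ x, ‖curl v x‖ ^ 2 with hZdef
  set Pal : ℝ := ∫ x, frobeniusNormSq (fderiv ℝ (curl v) x) with hPaldef
  set S : ℝ := ∫ x, ⟪curl v x, fderiv ℝ v x (curl v x)⟫_ℝ with hSdef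
  by_contra hcon
  push Not at hcon
  -- regularity and integrability
  have hv2 : ContDiff ℝ 2 v := hv.of_le (by norm_cast)
  have hω1 : ContDiff ℝ 1 (curl v) := contDiff_curl (n := 1) (hv.of_le (by norm_cast))
  have hωc : Continuous (curl v) := hω1.continuous
  have hDωc : Continuous (fderiv ℝ (curl v)) := hω1.continuous_fderiv one_ne_zero
  have hDvc : Continuous (fderiv ℝ v) := hv2.continuous_fderiv (by norm_num)
  have hZi : Integrable (fun x => ‖curl v x‖ ^ 2) := by
    by_contra h
    rw [hZdef, integral_undef h] at hZ
    exact lt_irrefl _ hZ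
  have hPi : Integrable (fun x => frobeniusNormSq (fderiv ℝ (curl v) x)) := by
    by_contra h
    rw [hPaldef, integral_undef h] at hPal
    exact lt_irrefl _ hPal
  have hPop : Integrable (fun x => ‖fderiv ℝ (curl v) x‖ ^ 2) :=
    hPi.mono' ((hDωc.norm.pow 2).aestronglyMeasurable) (ae_of_all _ fun x => by
      rw [Real.norm_eq_abs, abs_of_nonneg (by positivity)]
      exact sq_opNorm_le_frobeniusNormSq _)
  have hPop_le : ∫ x, ‖fderiv ℝ (curl v) x‖ ^ 2 ≤ Pal :=
    integral_mono hPop hPi fun x => sq_opNorm_le_frobeniusNormSq _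
  have hL2 : ∫⁻ x, ‖v x‖ₑ ^ 2 < ⊤ := by
    have h : ∀ x, ‖iteratedFDeriv ℝ 0 v x‖ₑ = ‖v x‖ₑ := fun x => by
      rw [← ofReal_norm, norm_iteratedFDeriv_zero, ofReal_norm]
    simpa only [h] using h0
  -- the scale
  set R : ℝ := Real.sqrt (Z / Pal) with hRdef
  have hR : 0 < R := Real.sqrt_pos.2 (div_pos hZ hPal)
  have hR2 : R ^ 2 = Z / Pal := Real.sq_sqrt (div_pos hZ hPal).le
  have hZ0 : Z ≠ 0 := hZ.ne'
  have hPal0 : Pal ≠ 0 := hPal.ne'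
  have hLR : (L / R) ^ 2 * Z = L ^ 2 * Pal := by
    rw [div_pow, hR2]
    field_simp
  -- the weighted `H¹` density of `ω` and its masses
  set e : EuclideanSpace ℝ (Fin 3) → ℝ :=
    fun y => ‖fderiv ℝ (curl v) y‖ ^ 2 + (L / R) ^ 2 * ‖curl v y‖ ^ 2 with he
  have hec : Continuous e := (hDωc.norm.pow 2).add (continuous_const.mul (hωc.norm.pow 2))
  have hei : Integrable e := hPop.add (hZi.const_mul _)
  have he0 : ∀ x, 0 ≤ e x := fun x => by positivity
  have hE' : ∫ x, e x ≤ (1 + L ^ 2) * Pal := by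
    have h1 : ∫ x, e x = (∫ x, ‖fderiv ℝ (curl v) x‖ ^ 2) + (L / R) ^ 2 * Z := by
      rw [he, integral_add hPop (hZi.const_mul _), integral_const_mul]
    rw [h1, hLR]
    linarith
  -- every closed ball of radius `2R` carries `≤ δZ` enstrophy and `≤ Pal(1+L²δ)` weighted mass
  have hr2 : χ.rOut * R = 2 * R := by rw [hχout]
  have hμa : ∀ a, ∫ x in closedBall a (χ.rOut * R), ‖curl v x‖ ^ 2 ≤ δ * Z := by
    intro a
    have hsub : closedBall a (χ.rOut * R) ⊆ ball a (4 * R) := by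
      rw [hr2]; exact closedBall_subset_ball (by linarith)
    calc ∫ x in closedBall a (χ.rOut * R), ‖curl v x‖ ^ 2
        ≤ ∫ x in ball a (4 * R), ‖curl v x‖ ^ 2 :=
          setIntegral_mono_set hZi.integrableOn (ae_of_all _ fun x => by positivity)
            hsub.eventuallyLE
      _ ≤ δ * Z := (hcon a).le
  have hEa : ∀ a, ∫ x in closedBall a (χ.rOut * R), e x ≤ Pal * (1 + L ^ 2 * δ) := by
    intro a
    have h1 : ∫ x in closedBall a (χ.rOut * R), ‖fderiv ℝ (curl v) x‖ ^ 2 ≤ Pal :=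
      (setIntegral_le_integral hPop (ae_of_all _ fun x => by positivity)).trans hPop_le
    have h2 := hμa a
    have h3 : ∫ x in closedBall a (χ.rOut * R), e x =
        (∫ x in closedBall a (χ.rOut * R), ‖fderiv ℝ (curl v) x‖ ^ 2) +
          (L / R) ^ 2 * ∫ x in closedBall a (χ.rOut * R), ‖curl v x‖ ^ 2 := by
      rw [he, integral_add hPop.integrableOn (hZi.const_mul _).integrableOn, integral_const_mul]
    have h4 : (L / R) ^ 2 * (δ * Z) = Pal * (L ^ 2 * δ) := by
      rw [show (L / R) ^ 2 * (δ * Z) = δ * ((L / R) ^ 2 * Z) by ring, hLR]; ring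
    rw [h3]
    calc (∫ x in closedBall a (χ.rOut * R), ‖fderiv ℝ (curl v) x‖ ^ 2) +
          (L / R) ^ 2 * ∫ x in closedBall a (χ.rOut * R), ‖curl v x‖ ^ 2
        ≤ Pal + (L / R) ^ 2 * (δ * Z) := by gcongr
      _ = Pal * (1 + L ^ 2 * δ) := by rw [h4]; ring
  -- the `L⁴` masses of the localised vorticities, integrated over the centre
  set c : ℝ := 2 * K ^ 3 * Real.sqrt (δ * Z) * Real.sqrt (2 * (Pal * (1 + L ^ 2 * δ))) with hc
  have hc0 : 0 ≤ c := by positivity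
  set A : EuclideanSpace ℝ (Fin 3) → ℝ≥0∞ :=
    fun a => ∫⁻ x, ‖(χ : EuclideanSpace ℝ (Fin 3) → ℝ) (R⁻¹ • (x - a)) • curl v x‖ₑ ^ 4 with hA
  set B : EuclideanSpace ℝ (Fin 3) → ℝ≥0∞ :=
    fun a => ∫⁻ x, (closedBall a (χ.rOut * R)).indicator (fun y => ‖fderiv ℝ v y‖ₑ ^ 2) x with hB
  have hAa : ∀ a, A a ≤ ENNReal.ofReal c *
      ∫⁻ x, (closedBall a (χ.rOut * R)).indicator (fun y => ENNReal.ofReal (e y)) x :=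
    fun a => lintegral_loc_pow_four_le χ hR hL a hω1 (hμa a) (hEa a)
  set m : ℝ≥0∞ := volume (closedBall (0 : EuclideanSpace ℝ (Fin 3)) (χ.rIn * R)) with hm
  set V₂ : ℝ≥0∞ := volume (closedBall (0 : EuclideanSpace ℝ (Fin 3)) (χ.rOut * R)) with hV₂
  have hm0 : m ≠ 0 := (measure_closedBall_pos volume _ (by rw [hχin]; linarith)).ne'
  have hmtop : m ≠ ⊤ := measure_closedBall_lt_top.ne
  have hV₂eq : V₂ = 8 * m := by
    rw [hV₂, hm, hr2, hχin, one_mul]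
    exact volume_closedBall_two_mul hR.le
  have hAtot : ∫⁻ a, A a ≤ ENNReal.ofReal c * (V₂ * ENNReal.ofReal (∫ x, e x)) :=
    lintegral_lintegral_loc_pow_four_le (v := v) χ hR hec hei he0 hAa
  have hBtot : ∫⁻ a, B a ≤ V₂ * ENNReal.ofReal Z :=
    lintegral_lintegral_ball_fderiv_le hv2 hdiv hL2 hZi (mul_pos χ.rOut_pos hR).le
  -- the continuous partition of unity and Tonelli
  have step1 : ∫⁻ x, ‖curl v x‖ₑ ^ 2 * ‖fderiv ℝ v x‖ₑ ≤
      m⁻¹ * ∫⁻ x, ∫⁻ a, ENNReal.ofReal ((χ : EuclideanSpace ℝ (Fin 3) → ℝ) (R⁻¹ • (x - a)) ^ 2) *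
        (‖curl v x‖ₑ ^ 2 * ‖fderiv ℝ v x‖ₑ) := by
    rw [← lintegral_const_mul' _ _ (ENNReal.inv_ne_top.2 hm0)]
    refine lintegral_mono fun x => ?_
    have hmeas : Measurable fun a : EuclideanSpace ℝ (Fin 3) =>
        ENNReal.ofReal ((χ : EuclideanSpace ℝ (Fin 3) → ℝ) (R⁻¹ • (x - a)) ^ 2) :=
      ENNReal.measurable_ofReal.comp
        (((χ.continuous.comp (by fun_prop)).pow 2).measurable)
    rw [lintegral_mul_const _ hmeas]
    calc ‖curl v x‖ₑ ^ 2 * ‖fderiv ℝ v x‖ₑ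
        = m⁻¹ * (m * (‖curl v x‖ₑ ^ 2 * ‖fderiv ℝ v x‖ₑ)) := by
          rw [← mul_assoc, ENNReal.inv_mul_cancel hm0 hmtop, one_mul]
      _ ≤ m⁻¹ * ((∫⁻ a, ENNReal.ofReal ((χ : EuclideanSpace ℝ (Fin 3) → ℝ) (R⁻¹ • (x - a)) ^ 2)) *
          (‖curl v x‖ₑ ^ 2 * ‖fderiv ℝ v x‖ₑ)) := by
          gcongr
          exact volume_closedBall_le_lintegral_bump_sq χ hR x
  have hΦ : Measurable (uncurry fun x a : EuclideanSpace ℝ (Fin 3) =>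
      ENNReal.ofReal ((χ : EuclideanSpace ℝ (Fin 3) → ℝ) (R⁻¹ • (x - a)) ^ 2) *
        (‖curl v x‖ₑ ^ 2 * ‖fderiv ℝ v x‖ₑ)) := by
    have h1 : Measurable fun p : EuclideanSpace ℝ (Fin 3) × EuclideanSpace ℝ (Fin 3) =>
        ENNReal.ofReal ((χ : EuclideanSpace ℝ (Fin 3) → ℝ) (R⁻¹ • (p.1 - p.2)) ^ 2) :=
      ENNReal.measurable_ofReal.comp
        (((χ.continuous.comp (by fun_prop)).pow 2).measurable)
    have h2 : Measurable fun p : EuclideanSpace ℝ (Fin 3) × EuclideanSpace ℝ (Fin 3) =>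
        ‖curl v p.1‖ₑ ^ 2 * ‖fderiv ℝ v p.1‖ₑ :=
      (((hωc.comp continuous_fst).measurable.enorm).pow_const _).mul
        (hDvc.comp continuous_fst).measurable.enorm
    exact h1.mul h2
  have step2 : ∫⁻ x, ∫⁻ a, ENNReal.ofReal ((χ : EuclideanSpace ℝ (Fin 3) → ℝ) (R⁻¹ • (x - a)) ^ 2) *
        (‖curl v x‖ₑ ^ 2 * ‖fderiv ℝ v x‖ₑ) =
      ∫⁻ a, ∫⁻ x, ENNReal.ofReal ((χ : EuclideanSpace ℝ (Fin 3) → ℝ) (R⁻¹ • (x - a)) ^ 2) *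
        (‖curl v x‖ₑ ^ 2 * ‖fderiv ℝ v x‖ₑ) :=
    lintegral_lintegral_swap hΦ.aemeasurable
  have step3 : ∀ a, ∫⁻ x, ENNReal.ofReal ((χ : EuclideanSpace ℝ (Fin 3) → ℝ) (R⁻¹ • (x - a)) ^ 2) *
      (‖curl v x‖ₑ ^ 2 * ‖fderiv ℝ v x‖ₑ) ≤ A a ^ (1 / 2 : ℝ) * B a ^ (1 / 2 : ℝ) :=
    fun a => lintegral_bump_sq_mul_le χ hR a hωc hDvc
  have step4 : ∫⁻ a, A a ^ (1 / 2 : ℝ) * B a ^ (1 / 2 : ℝ) ≤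
      (∫⁻ a, A a) ^ (1 / 2 : ℝ) * (∫⁻ a, B a) ^ (1 / 2 : ℝ) := by
    have hAm : Measurable A := measurable_lintegral_loc_pow_four χ R hωc
    have hBm : Measurable B :=
      measurable_lintegral_indicator_closedBall _ ((hDvc.measurable.enorm).pow_const _)
    have H := ENNReal.lintegral_mul_le_Lp_mul_Lq volume Real.HolderConjugate.two_two
      (hAm.pow_const (1 / 2 : ℝ)).aemeasurable (hBm.pow_const (1 / 2 : ℝ)).aemeasurable
    have e1 : ∀ t : ℝ≥0∞, (t ^ (1 / 2 : ℝ)) ^ (2 : ℝ) = t := fun t => by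
      rw [← ENNReal.rpow_mul]; norm_num
    simpa only [Pi.mul_apply, e1] using H
  -- assembling
  have hchain : ENNReal.ofReal S ≤ m⁻¹ * ((∫⁻ a, A a) ^ (1 / 2 : ℝ) * (∫⁻ a, B a) ^ (1 / 2 : ℝ)) :=
    calc ENNReal.ofReal S ≤ ∫⁻ x, ‖curl v x‖ₑ ^ 2 * ‖fderiv ℝ v x‖ₑ := ofReal_stretching_le v
      _ ≤ m⁻¹ * ∫⁻ x, ∫⁻ a, ENNReal.ofReal ((χ : EuclideanSpace ℝ (Fin 3) → ℝ) (R⁻¹ • (x - a)) ^ 2) *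
            (‖curl v x‖ₑ ^ 2 * ‖fderiv ℝ v x‖ₑ) := step1
      _ = m⁻¹ * ∫⁻ a, ∫⁻ x, ENNReal.ofReal ((χ : EuclideanSpace ℝ (Fin 3) → ℝ) (R⁻¹ • (x - a)) ^ 2) *
            (‖curl v x‖ₑ ^ 2 * ‖fderiv ℝ v x‖ₑ) := by rw [step2]
      _ ≤ m⁻¹ * ∫⁻ a, A a ^ (1 / 2 : ℝ) * B a ^ (1 / 2 : ℝ) := by
          gcongr with a
          exact step3 a
      _ ≤ m⁻¹ * ((∫⁻ a, A a) ^ (1 / 2 : ℝ) * (∫⁻ a, B a) ^ (1 / 2 : ℝ)) := by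
          gcongr
  have hA' : ∫⁻ a, A a ≤ 8 * m * ENNReal.ofReal (c * ((1 + L ^ 2) * Pal)) := by
    calc ∫⁻ a, A a ≤ ENNReal.ofReal c * (V₂ * ENNReal.ofReal (∫ x, e x)) := hAtot
      _ ≤ ENNReal.ofReal c * (V₂ * ENNReal.ofReal ((1 + L ^ 2) * Pal)) := by
          gcongr
      _ = 8 * m * ENNReal.ofReal (c * ((1 + L ^ 2) * Pal)) := by
          rw [hV₂eq, ENNReal.ofReal_mul hc0]; ring
  have hB' : ∫⁻ a, B a ≤ 8 * m * ENNReal.ofReal Z := by rw [← hV₂eq]; exact hBtot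
  have hXY : (∫⁻ a, A a) ^ (1 / 2 : ℝ) * (∫⁻ a, B a) ^ (1 / 2 : ℝ) ≤
      8 * m * ENNReal.ofReal (Real.sqrt (c * ((1 + L ^ 2) * Pal) * Z)) := by
    calc (∫⁻ a, A a) ^ (1 / 2 : ℝ) * (∫⁻ a, B a) ^ (1 / 2 : ℝ)
        ≤ (8 * m * ENNReal.ofReal (c * ((1 + L ^ 2) * Pal))) ^ (1 / 2 : ℝ) *
            (8 * m * ENNReal.ofReal Z) ^ (1 / 2 : ℝ) := by
          gcongr
      _ = 8 * m * ENNReal.ofReal (Real.sqrt (c * ((1 + L ^ 2) * Pal) * Z)) := by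
          rw [← ENNReal.mul_rpow_of_nonneg _ _ (by norm_num : (0 : ℝ) ≤ 1 / 2),
            show 8 * m * ENNReal.ofReal (c * ((1 + L ^ 2) * Pal)) * (8 * m * ENNReal.ofReal Z) =
              (8 * m) ^ 2 * (ENNReal.ofReal (c * ((1 + L ^ 2) * Pal)) * ENNReal.ofReal Z) by ring,
            ENNReal.mul_rpow_of_nonneg _ _ (by norm_num : (0 : ℝ) ≤ 1 / 2),
            ← ENNReal.ofReal_mul (by positivity),
            ENNReal.ofReal_rpow_of_nonneg (by positivity) (by norm_num : (0 : ℝ) ≤ 1 / 2),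
            ← Real.sqrt_eq_rpow]
          congr 1
          rw [← ENNReal.rpow_natCast, ← ENNReal.rpow_mul]
          norm_num
  have hfinE : ENNReal.ofReal S ≤
      ENNReal.ofReal (8 * Real.sqrt (c * ((1 + L ^ 2) * Pal) * Z)) := by
    calc ENNReal.ofReal S
        ≤ m⁻¹ * ((∫⁻ a, A a) ^ (1 / 2 : ℝ) * (∫⁻ a, B a) ^ (1 / 2 : ℝ)) := hchain
      _ ≤ m⁻¹ * (8 * m * ENNReal.ofReal (Real.sqrt (c * ((1 + L ^ 2) * Pal) * Z))) := by
          gcongr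
      _ = 8 * ENNReal.ofReal (Real.sqrt (c * ((1 + L ^ 2) * Pal) * Z)) := by
          rw [← mul_assoc, show m⁻¹ * (8 * m) = 8 by
            rw [mul_comm 8 m, ← mul_assoc, ENNReal.inv_mul_cancel hm0 hmtop, one_mul]]
      _ = ENNReal.ofReal (8 * Real.sqrt (c * ((1 + L ^ 2) * Pal) * Z)) := by
          rw [ENNReal.ofReal_mul (by norm_num), ENNReal.ofReal_ofNat]
  have hfin : S ≤ 8 * Real.sqrt (c * ((1 + L ^ 2) * Pal) * Z) :=
    (ENNReal.ofReal_le_ofReal_iff (by positivity)).1 hfinE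
  have h2 : S ≤ 8 * Real.sqrt (2 * K ^ 3 * Real.sqrt (δ * Z) *
      Real.sqrt (2 * (Pal * (1 + L ^ 2 * δ))) * (1 + L ^ 2) * Pal * Z) := by
    have : 2 * K ^ 3 * Real.sqrt (δ * Z) * Real.sqrt (2 * (Pal * (1 + L ^ 2 * δ))) *
        (1 + L ^ 2) * Pal * Z = c * ((1 + L ^ 2) * Pal) * Z := by rw [hc]; ring
    rw [this]; exact hfin
  exact final_algebra hε hZ hPal hK0 hδ1 hδ0.le hδb hS h2

end Summit.NavierStokesRegularity.NavierStokesRegularity.Theorems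

end
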